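import Summits.AtomisticToContinuum.Crystallization.Theorems.ExcessDecayLiouvilleHcpLiouvilleCoercive

/-!
# `ExcessDecayLiouville.HcpLiouville` (stmt-AtomisticToContinuum-9332), line `Sketch`: the linear Caccioppoli inequality

Steps (4) and (6) of stub `stub_flatDifferences` (level 2 of the two-level Caccioppoli argument), in
the notation of `…HcpLiouvilleCoercive` (`w = u₁ − u`, cut-off `χ`, `φ = χ·w`, `ψ = χ²·w`, bonds `a_pq`,
`b_pq = a_pq + δ_pq`, `δ_pq = w p − w q`).  Hypothesis: the DIFFERENCE EQUATION
`Σ_{q ≠ p} [F(b_pq) − F(a_pq)] = 0` at every site `p` (`F(e) = (V′(|e|)/|e|)·e`; it holds when `u` and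
`u₁` are the displacement forms of an equilibrium and of its translate by a period, file
`…HcpLiouvilleDifferenceEquation`).

* `secant_eq_mid_add_comm` : per bond, `secHess a δ (φ p − φ q) = ⟪F(b) − F(a), ψ p − ψ q⟫ + ¼(χ p − χ q)²
  (secHess a δ (w p + w q) − secHess a δ (w p − w q))` (the discrete product rule, from the pair calculus);
* `tsum_mid_eq_zero` : testing the difference equation against `ψ` — the middle terms sum to `0` over
  `↥S × ↥S` (row sums vanish by the equation, column sums by oddness of `F`, Fubini by absolute
  summability);
* `secForm_le` : hence `Σ_{(p,q)} secHess a_pq δ_pq (φ p − φ q) ≤ 904(10/9)⁸ · B` whenever the commutator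
  weights `M(p,q) = (χ p − χ q)² (dist p q)⁻⁸ ‖w p‖²` have partial sums `≤ B`;
* `flatDiff_caccioppoli_estimate` : with `…Coercive.coercive_integrated`, `2κ₁ · nnForm t A φ ≤ 904(10/9)⁸ · B`.

All `[folklore]`; a `--supports` helper for item stmt-AtomisticToContinuum-9332, nothing here closes an
item.
-/

noncomputable section

namespace Summit.AtomisticToContinuum.Crystallization.Theorems.ExcessDecayLiouville

open scoped BigOperators Topology Classical InnerProductSpace
open Literature.MathematicalPhysics.StatisticalMechanics
open Summit.AtomisticToContinuum.Crystallization.Theses.ExcessDecayLiouville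
open Summit.AtomisticToContinuum.Crystallization.Theorems.PhononStabilityNegative

section Caccioppoli

variable {t : Fin 2 → (EuclideanSpace ℝ (Fin 3))} {A : (EuclideanSpace ℝ (Fin 3)) →L[ℝ] (EuclideanSpace ℝ (Fin 3))} {u u₁ : (EuclideanSpace ℝ (Fin 3)) → (EuclideanSpace ℝ (Fin 3))} {c : (EuclideanSpace ℝ (Fin 3))} {R κ₁ B : ℝ}


/-! ## The per-bond identity -/

/-- **Discrete product rule on a bond of the site set**: for distinct sites `p, q`,
`secHess a δ (φ p − φ q) = ⟪F(b) − F(a), ψ p − ψ q⟫ + ¼(χ p − χ q)²(secHess a δ (w p + w q) − secHess a δ (w p − w q))`.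
[folklore] -/
private theorem secant_eq_mid_add_comm (hA : Adm₀ A) (hI : Inner₀ t A) (hu : ∀ s ∈ Sites₀ t A, ‖u s‖ ≤ 1 / 40)
    (hu₁ : ∀ s ∈ Sites₀ t A, ‖u₁ s‖ ≤ 1 / 40) {p q : (EuclideanSpace ℝ (Fin 3))} (hp : p ∈ Sites₀ t A) (hq : q ∈ Sites₀ t A)
    (hpq : p ≠ q) :
    secHess (((p : (EuclideanSpace ℝ (Fin 3))) + u p - ((q : (EuclideanSpace ℝ (Fin 3))) + u q))) (((u₁ p - u p) - (u₁ q - u q))) ((max 0 (min 1 (2 - dist (p : (EuclideanSpace ℝ (Fin 3))) c / R)) • (u₁ p - u p)) - (max 0 (min 1 (2 - dist (q : (EuclideanSpace ℝ (Fin 3))) c / R)) • (u₁ q - u q))) =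
      ⟪((deriv lennardJones ‖((p : (EuclideanSpace ℝ (Fin 3))) + u₁ p - ((q : (EuclideanSpace ℝ (Fin 3))) + u₁ q))‖ / ‖((p : (EuclideanSpace ℝ (Fin 3))) + u₁ p - ((q : (EuclideanSpace ℝ (Fin 3))) + u₁ q))‖) • (((p : (EuclideanSpace ℝ (Fin 3))) + u₁ p - ((q : (EuclideanSpace ℝ (Fin 3))) + u₁ q)))) - ((deriv lennardJones ‖((p : (EuclideanSpace ℝ (Fin 3))) + u p - ((q : (EuclideanSpace ℝ (Fin 3))) + u q))‖ / ‖((p : (EuclideanSpace ℝ (Fin 3))) + u p - ((q : (EuclideanSpace ℝ (Fin 3))) + u q))‖) • (((p : (EuclideanSpace ℝ (Fin 3))) + u p - ((q : (EuclideanSpace ℝ (Fin 3))) + u q)))), ((max 0 (min 1 (2 - dist (p : (EuclideanSpace ℝ (Fin 3))) c / R))) ^ 2 • (u₁ p - u p)) - ((max 0 (min 1 (2 - dist (q : (EuclideanSpace ℝ (Fin 3))) c / R))) ^ 2 • (u₁ q - u q))⟫_ℝ +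
        ((max 0 (min 1 (2 - dist (p : (EuclideanSpace ℝ (Fin 3))) c / R))) - (max 0 (min 1 (2 - dist (q : (EuclideanSpace ℝ (Fin 3))) c / R)))) ^ 2 / 4 *
          (secHess (((p : (EuclideanSpace ℝ (Fin 3))) + u p - ((q : (EuclideanSpace ℝ (Fin 3))) + u q))) (((u₁ p - u p) - (u₁ q - u q))) ((u₁ p - u p) + (u₁ q - u q)) -
            secHess (((p : (EuclideanSpace ℝ (Fin 3))) + u p - ((q : (EuclideanSpace ℝ (Fin 3))) + u q))) (((u₁ p - u p) - (u₁ q - u q))) ((u₁ p - u p) - (u₁ q - u q))) := by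
  have h := flatDiff_secHess_cutoff_identity (((p : (EuclideanSpace ℝ (Fin 3))) + u p - ((q : (EuclideanSpace ℝ (Fin 3))) + u q))) (u₁ p - u p) (u₁ q - u q) ((max 0 (min 1 (2 - dist (p : (EuclideanSpace ℝ (Fin 3))) c / R)))) ((max 0 (min 1 (2 - dist (q : (EuclideanSpace ℝ (Fin 3))) c / R))))
    (fun θ hθ => flatDiff_chord_ne_zero hA hI hu hu₁ hp hq hpq hθ)
  have hb : ((p : (EuclideanSpace ℝ (Fin 3))) + u p - ((q : (EuclideanSpace ℝ (Fin 3))) + u q)) + ((u₁ p - u p) - (u₁ q - u q)) = ((p : (EuclideanSpace ℝ (Fin 3))) + u₁ p - ((q : (EuclideanSpace ℝ (Fin 3))) + u₁ q)) := by abel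
  rw [hb] at h
  exact h

/-! ## The commutator term -/

/-- Pointwise bound of the commutator term by the symmetrised weights
`½·904(10/9)⁸ (M(p,q) + M(q,p))`, `M(p,q) = (χ p − χ q)² (dist p q)⁻⁸ ‖w p‖²`. [folklore] -/
private theorem abs_comm_le (hA : Adm₀ A) (hI : Inner₀ t A) (hu : ∀ s ∈ Sites₀ t A, ‖u s‖ ≤ 1 / 40)
    (hu₁ : ∀ s ∈ Sites₀ t A, ‖u₁ s‖ ≤ 1 / 40) (p q : Sites₀ t A) :
    |(if (p : (EuclideanSpace ℝ (Fin 3))) ≠ q then ((max 0 (min 1 (2 - dist (p : (EuclideanSpace ℝ (Fin 3))) c / R))) - (max 0 (min 1 (2 - dist (q : (EuclideanSpace ℝ (Fin 3))) c / R)))) ^ 2 / 4 *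
        (secHess (((p : (EuclideanSpace ℝ (Fin 3))) + u p - ((q : (EuclideanSpace ℝ (Fin 3))) + u q))) (((u₁ p - u p) - (u₁ q - u q))) ((u₁ p - u p) + (u₁ q - u q)) -
          secHess (((p : (EuclideanSpace ℝ (Fin 3))) + u p - ((q : (EuclideanSpace ℝ (Fin 3))) + u q))) (((u₁ p - u p) - (u₁ q - u q))) ((u₁ p - u p) - (u₁ q - u q))) else 0)| ≤
      904 * (10 / 9) ^ 8 / 2 *
        ((if (p : (EuclideanSpace ℝ (Fin 3))) ≠ q then ((max 0 (min 1 (2 - dist (p : (EuclideanSpace ℝ (Fin 3))) c / R))) - (max 0 (min 1 (2 - dist (q : (EuclideanSpace ℝ (Fin 3))) c / R)))) ^ 2 * (dist (p : (EuclideanSpace ℝ (Fin 3))) q)⁻¹ ^ 8 * ‖u₁ p - u p‖ ^ 2 else 0) +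
         (if (q : (EuclideanSpace ℝ (Fin 3))) ≠ p then ((max 0 (min 1 (2 - dist (q : (EuclideanSpace ℝ (Fin 3))) c / R))) - (max 0 (min 1 (2 - dist (p : (EuclideanSpace ℝ (Fin 3))) c / R)))) ^ 2 * (dist (q : (EuclideanSpace ℝ (Fin 3))) p)⁻¹ ^ 8 * ‖u₁ q - u q‖ ^ 2 else 0)) := by
  by_cases hpq : (p : (EuclideanSpace ℝ (Fin 3))) ≠ q
  · rw [if_pos hpq, if_pos hpq, if_pos (Ne.symm hpq), dist_comm (q : (EuclideanSpace ℝ (Fin 3))) p]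
    have h1 := flatDiff_abs_secHess_sites_le hA hI hu hu₁ p.2 q.2 hpq ((u₁ p - u p) + (u₁ q - u q))
    have h2 := flatDiff_abs_secHess_sites_le hA hI hu hu₁ p.2 q.2 hpq ((u₁ p - u p) - (u₁ q - u q))
    have hpar := parallelogram_law_with_norm ℝ (u₁ p - u p) (u₁ q - u q)
    have hsq : ((max 0 (min 1 (2 - dist (q : (EuclideanSpace ℝ (Fin 3))) c / R))) - (max 0 (min 1 (2 - dist (p : (EuclideanSpace ℝ (Fin 3))) c / R)))) ^ 2 = ((max 0 (min 1 (2 - dist (p : (EuclideanSpace ℝ (Fin 3))) c / R))) - (max 0 (min 1 (2 - dist (q : (EuclideanSpace ℝ (Fin 3))) c / R)))) ^ 2 := by ring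
    rw [hsq, abs_mul, abs_of_nonneg (by positivity : (0 : ℝ) ≤ ((max 0 (min 1 (2 - dist (p : (EuclideanSpace ℝ (Fin 3))) c / R))) - (max 0 (min 1 (2 - dist (q : (EuclideanSpace ℝ (Fin 3))) c / R)))) ^ 2 / 4)]
    have hc0 : (0 : ℝ) ≤ ((max 0 (min 1 (2 - dist (p : (EuclideanSpace ℝ (Fin 3))) c / R))) - (max 0 (min 1 (2 - dist (q : (EuclideanSpace ℝ (Fin 3))) c / R)))) ^ 2 := sq_nonneg _
    have hd0 : (0 : ℝ) ≤ (dist (p : (EuclideanSpace ℝ (Fin 3))) q)⁻¹ ^ 8 := by positivity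
    have hsub := abs_sub _ _ |>.trans (add_le_add h1 h2)
    calc ((max 0 (min 1 (2 - dist (p : (EuclideanSpace ℝ (Fin 3))) c / R))) - (max 0 (min 1 (2 - dist (q : (EuclideanSpace ℝ (Fin 3))) c / R)))) ^ 2 / 4 * |secHess (((p : (EuclideanSpace ℝ (Fin 3))) + u p - ((q : (EuclideanSpace ℝ (Fin 3))) + u q))) (((u₁ p - u p) - (u₁ q - u q))) ((u₁ p - u p) + (u₁ q - u q)) -
          secHess (((p : (EuclideanSpace ℝ (Fin 3))) + u p - ((q : (EuclideanSpace ℝ (Fin 3))) + u q))) (((u₁ p - u p) - (u₁ q - u q))) ((u₁ p - u p) - (u₁ q - u q))|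
        ≤ ((max 0 (min 1 (2 - dist (p : (EuclideanSpace ℝ (Fin 3))) c / R))) - (max 0 (min 1 (2 - dist (q : (EuclideanSpace ℝ (Fin 3))) c / R)))) ^ 2 / 4 * (904 * (10 / 9) ^ 8 * (dist (p : (EuclideanSpace ℝ (Fin 3))) q)⁻¹ ^ 8 *
            ‖(u₁ p - u p) + (u₁ q - u q)‖ ^ 2 +
            904 * (10 / 9) ^ 8 * (dist (p : (EuclideanSpace ℝ (Fin 3))) q)⁻¹ ^ 8 * ‖(u₁ p - u p) - (u₁ q - u q)‖ ^ 2) := by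
          gcongr
      _ = _ := by rw [← mul_add, hpar]; ring
  · rw [if_neg hpq, if_neg hpq, if_neg (fun h => hpq (Ne.symm h))]
    simp

/-- Summability of the commutator weights `M` from bounded partial sums. [folklore] -/
private theorem summable_weights
    (hM : ∀ U : Finset (Sites₀ t A × Sites₀ t A), ∑ pq ∈ U, (if (pq.1 : (EuclideanSpace ℝ (Fin 3))) ≠ pq.2 then
      ((max 0 (min 1 (2 - dist (pq.1 : (EuclideanSpace ℝ (Fin 3))) c / R))) - (max 0 (min 1 (2 - dist (pq.2 : (EuclideanSpace ℝ (Fin 3))) c / R)))) ^ 2 * (dist (pq.1 : (EuclideanSpace ℝ (Fin 3))) pq.2)⁻¹ ^ 8 * ‖u₁ pq.1 - u pq.1‖ ^ 2 else 0) ≤ B) :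
    Summable (fun pq : Sites₀ t A × Sites₀ t A => (if (pq.1 : (EuclideanSpace ℝ (Fin 3))) ≠ pq.2 then
      ((max 0 (min 1 (2 - dist (pq.1 : (EuclideanSpace ℝ (Fin 3))) c / R))) - (max 0 (min 1 (2 - dist (pq.2 : (EuclideanSpace ℝ (Fin 3))) c / R)))) ^ 2 * (dist (pq.1 : (EuclideanSpace ℝ (Fin 3))) pq.2)⁻¹ ^ 8 * ‖u₁ pq.1 - u pq.1‖ ^ 2 else 0)) ∧
    ∑' pq : Sites₀ t A × Sites₀ t A, (if (pq.1 : (EuclideanSpace ℝ (Fin 3))) ≠ pq.2 then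
      ((max 0 (min 1 (2 - dist (pq.1 : (EuclideanSpace ℝ (Fin 3))) c / R))) - (max 0 (min 1 (2 - dist (pq.2 : (EuclideanSpace ℝ (Fin 3))) c / R)))) ^ 2 * (dist (pq.1 : (EuclideanSpace ℝ (Fin 3))) pq.2)⁻¹ ^ 8 * ‖u₁ pq.1 - u pq.1‖ ^ 2 else 0) ≤ B := by
  have hnn : ∀ pq : Sites₀ t A × Sites₀ t A, 0 ≤ (if (pq.1 : (EuclideanSpace ℝ (Fin 3))) ≠ pq.2 then
      ((max 0 (min 1 (2 - dist (pq.1 : (EuclideanSpace ℝ (Fin 3))) c / R))) - (max 0 (min 1 (2 - dist (pq.2 : (EuclideanSpace ℝ (Fin 3))) c / R)))) ^ 2 * (dist (pq.1 : (EuclideanSpace ℝ (Fin 3))) pq.2)⁻¹ ^ 8 * ‖u₁ pq.1 - u pq.1‖ ^ 2 else 0) :=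
    fun pq => by split_ifs <;> positivity
  have hs := summable_of_sum_le hnn hM
  exact ⟨hs, hs.tsum_le_of_sum_le hM⟩

/-- Summability of the commutator family over `↥S × ↥S`. [folklore] -/
private theorem summable_comm (hA : Adm₀ A) (hI : Inner₀ t A) (hu : ∀ s ∈ Sites₀ t A, ‖u s‖ ≤ 1 / 40)
    (hu₁ : ∀ s ∈ Sites₀ t A, ‖u₁ s‖ ≤ 1 / 40)
    (hM : ∀ U : Finset (Sites₀ t A × Sites₀ t A), ∑ pq ∈ U, (if (pq.1 : (EuclideanSpace ℝ (Fin 3))) ≠ pq.2 then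
      ((max 0 (min 1 (2 - dist (pq.1 : (EuclideanSpace ℝ (Fin 3))) c / R))) - (max 0 (min 1 (2 - dist (pq.2 : (EuclideanSpace ℝ (Fin 3))) c / R)))) ^ 2 * (dist (pq.1 : (EuclideanSpace ℝ (Fin 3))) pq.2)⁻¹ ^ 8 * ‖u₁ pq.1 - u pq.1‖ ^ 2 else 0) ≤ B) :
    Summable (Function.uncurry fun p q : Sites₀ t A =>
      (if (p : (EuclideanSpace ℝ (Fin 3))) ≠ q then ((max 0 (min 1 (2 - dist (p : (EuclideanSpace ℝ (Fin 3))) c / R))) - (max 0 (min 1 (2 - dist (q : (EuclideanSpace ℝ (Fin 3))) c / R)))) ^ 2 / 4 *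
        (secHess (((p : (EuclideanSpace ℝ (Fin 3))) + u p - ((q : (EuclideanSpace ℝ (Fin 3))) + u q))) (((u₁ p - u p) - (u₁ q - u q))) ((u₁ p - u p) + (u₁ q - u q)) -
          secHess (((p : (EuclideanSpace ℝ (Fin 3))) + u p - ((q : (EuclideanSpace ℝ (Fin 3))) + u q))) (((u₁ p - u p) - (u₁ q - u q))) ((u₁ p - u p) - (u₁ q - u q))) else 0)) := by
  obtain ⟨hs, -⟩ := summable_weights hM
  refine Summable.of_norm_bounded ((hs.add hs.prod_symm).mul_left (904 * (10 / 9) ^ 8 / 2)) ?_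
  intro pq
  rw [Real.norm_eq_abs]
  exact abs_comm_le hA hI hu hu₁ pq.1 pq.2

/-- The sum of the commutator family is at most `904(10/9)⁸ · B`. [folklore] -/
private theorem tsum_comm_le (hA : Adm₀ A) (hI : Inner₀ t A) (hu : ∀ s ∈ Sites₀ t A, ‖u s‖ ≤ 1 / 40)
    (hu₁ : ∀ s ∈ Sites₀ t A, ‖u₁ s‖ ≤ 1 / 40)
    (hM : ∀ U : Finset (Sites₀ t A × Sites₀ t A), ∑ pq ∈ U, (if (pq.1 : (EuclideanSpace ℝ (Fin 3))) ≠ pq.2 then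
      ((max 0 (min 1 (2 - dist (pq.1 : (EuclideanSpace ℝ (Fin 3))) c / R))) - (max 0 (min 1 (2 - dist (pq.2 : (EuclideanSpace ℝ (Fin 3))) c / R)))) ^ 2 * (dist (pq.1 : (EuclideanSpace ℝ (Fin 3))) pq.2)⁻¹ ^ 8 * ‖u₁ pq.1 - u pq.1‖ ^ 2 else 0) ≤ B) :
    ∑' pq : Sites₀ t A × Sites₀ t A,
      (if (pq.1 : (EuclideanSpace ℝ (Fin 3))) ≠ pq.2 then ((max 0 (min 1 (2 - dist (pq.1 : (EuclideanSpace ℝ (Fin 3))) c / R))) - (max 0 (min 1 (2 - dist (pq.2 : (EuclideanSpace ℝ (Fin 3))) c / R)))) ^ 2 / 4 *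
        (secHess (((pq.1 : (EuclideanSpace ℝ (Fin 3))) + u pq.1 - ((pq.2 : (EuclideanSpace ℝ (Fin 3))) + u pq.2))) (((u₁ pq.1 - u pq.1) - (u₁ pq.2 - u pq.2))) ((u₁ pq.1 - u pq.1) + (u₁ pq.2 - u pq.2)) -
          secHess (((pq.1 : (EuclideanSpace ℝ (Fin 3))) + u pq.1 - ((pq.2 : (EuclideanSpace ℝ (Fin 3))) + u pq.2))) (((u₁ pq.1 - u pq.1) - (u₁ pq.2 - u pq.2))) ((u₁ pq.1 - u pq.1) - (u₁ pq.2 - u pq.2))) else 0) ≤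
      904 * (10 / 9) ^ 8 * B := by
  obtain ⟨hs, hle⟩ := summable_weights hM
  have hcomm := summable_comm hA hI hu hu₁ hM
  have hswap : ∑' pq : Sites₀ t A × Sites₀ t A, (if (pq.2 : (EuclideanSpace ℝ (Fin 3))) ≠ pq.1 then
      ((max 0 (min 1 (2 - dist (pq.2 : (EuclideanSpace ℝ (Fin 3))) c / R))) - (max 0 (min 1 (2 - dist (pq.1 : (EuclideanSpace ℝ (Fin 3))) c / R)))) ^ 2 * (dist (pq.2 : (EuclideanSpace ℝ (Fin 3))) pq.1)⁻¹ ^ 8 * ‖u₁ pq.2 - u pq.2‖ ^ 2 else 0) =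
      ∑' pq : Sites₀ t A × Sites₀ t A, (if (pq.1 : (EuclideanSpace ℝ (Fin 3))) ≠ pq.2 then
      ((max 0 (min 1 (2 - dist (pq.1 : (EuclideanSpace ℝ (Fin 3))) c / R))) - (max 0 (min 1 (2 - dist (pq.2 : (EuclideanSpace ℝ (Fin 3))) c / R)))) ^ 2 * (dist (pq.1 : (EuclideanSpace ℝ (Fin 3))) pq.2)⁻¹ ^ 8 * ‖u₁ pq.1 - u pq.1‖ ^ 2 else 0) :=
    (Equiv.prodComm (Sites₀ t A) (Sites₀ t A)).tsum_eq (fun pq : Sites₀ t A × Sites₀ t A =>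
      (if (pq.1 : (EuclideanSpace ℝ (Fin 3))) ≠ pq.2 then
        ((max 0 (min 1 (2 - dist (pq.1 : (EuclideanSpace ℝ (Fin 3))) c / R))) - (max 0 (min 1 (2 - dist (pq.2 : (EuclideanSpace ℝ (Fin 3))) c / R)))) ^ 2 * (dist (pq.1 : (EuclideanSpace ℝ (Fin 3))) pq.2)⁻¹ ^ 8 * ‖u₁ pq.1 - u pq.1‖ ^ 2 else 0))
  calc _ ≤ ∑' pq : Sites₀ t A × Sites₀ t A, 904 * (10 / 9) ^ 8 / 2 *
        ((if (pq.1 : (EuclideanSpace ℝ (Fin 3))) ≠ pq.2 then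
          ((max 0 (min 1 (2 - dist (pq.1 : (EuclideanSpace ℝ (Fin 3))) c / R))) - (max 0 (min 1 (2 - dist (pq.2 : (EuclideanSpace ℝ (Fin 3))) c / R)))) ^ 2 * (dist (pq.1 : (EuclideanSpace ℝ (Fin 3))) pq.2)⁻¹ ^ 8 * ‖u₁ pq.1 - u pq.1‖ ^ 2 else 0) +
         (if (pq.2 : (EuclideanSpace ℝ (Fin 3))) ≠ pq.1 then
          ((max 0 (min 1 (2 - dist (pq.2 : (EuclideanSpace ℝ (Fin 3))) c / R))) - (max 0 (min 1 (2 - dist (pq.1 : (EuclideanSpace ℝ (Fin 3))) c / R)))) ^ 2 * (dist (pq.2 : (EuclideanSpace ℝ (Fin 3))) pq.1)⁻¹ ^ 8 * ‖u₁ pq.2 - u pq.2‖ ^ 2 else 0)) :=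
        hcomm.tsum_le_tsum (fun pq => (le_abs_self _).trans (abs_comm_le hA hI hu hu₁ pq.1 pq.2))
          ((hs.add hs.prod_symm).mul_left _)
    _ = 904 * (10 / 9) ^ 8 / 2 * (∑' pq : Sites₀ t A × Sites₀ t A, (if (pq.1 : (EuclideanSpace ℝ (Fin 3))) ≠ pq.2 then
          ((max 0 (min 1 (2 - dist (pq.1 : (EuclideanSpace ℝ (Fin 3))) c / R))) - (max 0 (min 1 (2 - dist (pq.2 : (EuclideanSpace ℝ (Fin 3))) c / R)))) ^ 2 * (dist (pq.1 : (EuclideanSpace ℝ (Fin 3))) pq.2)⁻¹ ^ 8 * ‖u₁ pq.1 - u pq.1‖ ^ 2 else 0) +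
          ∑' pq : Sites₀ t A × Sites₀ t A, (if (pq.2 : (EuclideanSpace ℝ (Fin 3))) ≠ pq.1 then
          ((max 0 (min 1 (2 - dist (pq.2 : (EuclideanSpace ℝ (Fin 3))) c / R))) - (max 0 (min 1 (2 - dist (pq.1 : (EuclideanSpace ℝ (Fin 3))) c / R)))) ^ 2 * (dist (pq.2 : (EuclideanSpace ℝ (Fin 3))) pq.1)⁻¹ ^ 8 * ‖u₁ pq.2 - u pq.2‖ ^ 2 else 0)) := by
        rw [tsum_mul_left]
        congr 1
        exact hs.tsum_add hs.prod_symm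
    _ ≤ 904 * (10 / 9) ^ 8 * B := by rw [hswap]; nlinarith

/-! ## The middle term -/

/-- The pair force is odd. [folklore] -/
private theorem pairForce_neg (e : (EuclideanSpace ℝ (Fin 3))) : ((deriv lennardJones ‖-e‖ / ‖-e‖) • (-e)) = -((deriv lennardJones ‖e‖ / ‖e‖) • e) := by
  rw [norm_neg, smul_neg]

/-- Antisymmetry of the force differences: `F(b_pq) − F(a_pq) = −(F(b_qp) − F(a_qp))`. [folklore] -/
private theorem forceDiff_antisymm (p q : (EuclideanSpace ℝ (Fin 3))) :
    ((deriv lennardJones ‖((p : (EuclideanSpace ℝ (Fin 3))) + u₁ p - ((q : (EuclideanSpace ℝ (Fin 3))) + u₁ q))‖ / ‖((p : (EuclideanSpace ℝ (Fin 3))) + u₁ p - ((q : (EuclideanSpace ℝ (Fin 3))) + u₁ q))‖) • (((p : (EuclideanSpace ℝ (Fin 3))) + u₁ p - ((q : (EuclideanSpace ℝ (Fin 3))) + u₁ q)))) - ((deriv lennardJones ‖((p : (EuclideanSpace ℝ (Fin 3))) + u p - ((q : (EuclideanSpace ℝ (Fin 3))) + u q))‖ / ‖((p : (EuclideanSpace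 ℝ (Fin 3))) + u p - ((q : (EuclideanSpace ℝ (Fin 3))) + u q))‖) • (((p : (EuclideanSpace ℝ (Fin 3))) + u p - ((q : (EuclideanSpace ℝ (Fin 3))) + u q)))) = -(((deriv lennardJones ‖((q : (EuclideanSpace ℝ (Fin 3))) + u₁ q - ((p : (EuclideanSpace ℝ (Fin 3))) + u₁ p))‖ / ‖((q : (EuclideanSpace ℝ (Fin 3))) + u₁ q - ((p : (EuclideanSpace ℝ (Fin 3))) + u₁ p))‖) • (((q : (EuclideanSpace ℝ (Fin 3))) + u₁ q - ((p : (EuclideanSpace ℝ (Fin 3))) + u₁ p)))) - ((deriv lennardJones ‖((q : (EuclideanSpace ℝ (Fin 3))) + u q - ((p : (EuclideanSpace ℝ (Fin 3))) + u p))‖ / ‖((q : (EuclideanSpace ℝ (Fin 3))) + u q - ((p : (EuclideanSpace ℝ (Fin 3))) + u p))‖) • (((q : (EuclideanSpace ℝ (Fin 3))) + u q - ((p : (EuclideanSpace ℝ (Fin 3))) + u p))))) := by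
  have hb : ((p : (EuclideanSpace ℝ (Fin 3))) + u₁ p - ((q : (EuclideanSpace ℝ (Fin 3))) + u₁ q)) = -((q : (EuclideanSpace ℝ (Fin 3))) + u₁ q - ((p : (EuclideanSpace ℝ (Fin 3))) + u₁ p)) := by abel
  have ha : ((p : (EuclideanSpace ℝ (Fin 3))) + u p - ((q : (EuclideanSpace ℝ (Fin 3))) + u q)) = -((q : (EuclideanSpace ℝ (Fin 3))) + u q - ((p : (EuclideanSpace ℝ (Fin 3))) + u p)) := by abel
  rw [hb, ha, pairForce_neg, pairForce_neg]
  abel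

/-- **Row sums of the middle term vanish**: the difference equation at `p` tested against `ψ p`.
[folklore] -/
private theorem hasSum_mid_row
    (hEq : ∀ p : Sites₀ t A, HasSum (fun q : Sites₀ t A =>
      if (p : (EuclideanSpace ℝ (Fin 3))) ≠ q then ((deriv lennardJones ‖((p : (EuclideanSpace ℝ (Fin 3))) + u₁ p - ((q : (EuclideanSpace ℝ (Fin 3))) + u₁ q))‖ / ‖((p : (EuclideanSpace ℝ (Fin 3))) + u₁ p - ((q : (EuclideanSpace ℝ (Fin 3))) + u₁ q))‖) • (((p : (EuclideanSpace ℝ (Fin 3))) + u₁ p - ((q : (EuclideanSpace ℝ (Fin 3))) + u₁ q)))) - ((deriv lennardJones ‖((p : (EuclideanSpace ℝ (Fin 3))) + u p - ((q : (EuclideanSpace ℝ (Fin 3))) + u q))‖ / ‖((p : (EuclideanSpace ℝ (Fin 3))) + u p - ((q : (EuclideanSpace ℝ (Fin 3))) + u q))‖) • (((p : (EuclideanSpace ℝ (Fin 3))) + u p - ((q : (EuclideanSpace ℝ (Fin 3))) + u q)))) else 0) 0) (p : Sites₀ t A) :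
    HasSum (fun q : Sites₀ t A =>
      if (p : (EuclideanSpace ℝ (Fin 3))) ≠ q then ⟪((deriv lennardJones ‖((p : (EuclideanSpace ℝ (Fin 3))) + u₁ p - ((q : (EuclideanSpace ℝ (Fin 3))) + u₁ q))‖ / ‖((p : (EuclideanSpace ℝ (Fin 3))) + u₁ p - ((q : (EuclideanSpace ℝ (Fin 3))) + u₁ q))‖) • (((p : (EuclideanSpace ℝ (Fin 3))) + u₁ p - ((q : (EuclideanSpace ℝ (Fin 3))) + u₁ q)))) - ((deriv lennardJones ‖((p : (EuclideanSpace ℝ (Fin 3))) + u p - ((q : (EuclideanSpace ℝ (Fin 3))) + u q))‖ / ‖((p : (EuclideanSpace ℝ (Fin 3))) + u p - ((q : (EuclideanSpace ℝ (Fin 3))) + u q))‖) • (((p : (EuclideanSpace ℝ (Fin 3))) + u p - ((q : (EuclideanSpace ℝ (Fin 3))) + u q)))), ((max 0 (min 1 (2 - dist (p : (EuclideanSpace ℝ (Fin 3))) c / R))) ^ 2 • (u₁ p - u p))⟫_ℝ else 0) 0 := by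
  have h := (hEq p).mapL (innerSL ℝ (((max 0 (min 1 (2 - dist (p : (EuclideanSpace ℝ (Fin 3))) c / R))) ^ 2 • (u₁ p - u p))))
  rw [map_zero] at h
  refine h.congr_fun fun q => ?_
  split_ifs
  · rw [innerSL_apply_apply, real_inner_comm]
  · simp

/-- Summability over `↥S × ↥S` of the first half `⟪F(b) − F(a), ψ p⟫` of the middle term. [folklore] -/
private theorem summable_mid₁ (hA : Adm₀ A) (hI : Inner₀ t A) (hR : 0 < R)
    (hEq : ∀ p : Sites₀ t A, HasSum (fun q : Sites₀ t A =>
      if (p : (EuclideanSpace ℝ (Fin 3))) ≠ q then ((deriv lennardJones ‖((p : (EuclideanSpace ℝ (Fin 3))) + u₁ p - ((q : (EuclideanSpace ℝ (Fin 3))) + u₁ q))‖ / ‖((p : (EuclideanSpace ℝ (Fin 3))) + u₁ p - ((q : (EuclideanSpace ℝ (Fin 3))) + u₁ q))‖) • (((p : (EuclideanSpace ℝ (Fin 3))) + u₁ p - ((q : (EuclideanSpace ℝ (Fin 3))) + u₁ q)))) - ((deriv lennardJones ‖((p : (EuclideanSpace ℝ (Fin 3))) + u p - ((q : (EuclideanSpace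 ℝ (Fin 3))) + u q))‖ / ‖((p : (EuclideanSpace ℝ (Fin 3))) + u p - ((q : (EuclideanSpace ℝ (Fin 3))) + u q))‖) • (((p : (EuclideanSpace ℝ (Fin 3))) + u p - ((q : (EuclideanSpace ℝ (Fin 3))) + u q)))) else 0) 0) :
    Summable (Function.uncurry fun p q : Sites₀ t A =>
      if (p : (EuclideanSpace ℝ (Fin 3))) ≠ q then ⟪((deriv lennardJones ‖((p : (EuclideanSpace ℝ (Fin 3))) + u₁ p - ((q : (EuclideanSpace ℝ (Fin 3))) + u₁ q))‖ / ‖((p : (EuclideanSpace ℝ (Fin 3))) + u₁ p - ((q : (EuclideanSpace ℝ (Fin 3))) + u₁ q))‖) • (((p : (EuclideanSpace ℝ (Fin 3))) + u₁ p - ((q : (EuclideanSpace ℝ (Fin 3))) + u₁ q)))) - ((deriv lennardJones ‖((p : (EuclideanSpace ℝ (Fin 3))) + u p - ((q : (EuclideanSpace ℝ (Fin 3))) + u q))‖ / ‖((p : (EuclideanSpace ℝ (Fin 3))) + u p - ((q : (EuclideanSpace ℝ (Fin 3))) + u q))‖) • (((p : (EuclideanSpace ℝ (Fin 3))) + u p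 - ((q : (EuclideanSpace ℝ (Fin 3))) + u q)))), ((max 0 (min 1 (2 - dist (p : (EuclideanSpace ℝ (Fin 3))) c / R))) ^ 2 • (u₁ p - u p))⟫_ℝ else 0) := by
  set F : Finset (Sites₀ t A) := (flatDiff_finite_sites_ball hA hI c (2 * R)).toFinset with hF
  have hF0 : ∀ p : Sites₀ t A, p ∉ F → ((max 0 (min 1 (2 - dist (p : (EuclideanSpace ℝ (Fin 3))) c / R))) ^ 2 • (u₁ p - u p)) = 0 := by
    intro p hp
    have hfar : 2 * R ≤ dist (p : (EuclideanSpace ℝ (Fin 3))) c := by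
      by_contra h
      exact hp ((Set.Finite.mem_toFinset _).2 (le_of_lt (not_le.1 h)))
    rw [flatDiff_cutoff_eq_zero hR hfar]
    simp
  refine flatDiff_summable_uncurry_of_left_finset _ F (fun p hp q => ?_) fun p _ => (hasSum_mid_row hEq p).summable
  simp [hF0 p hp]

/-- Summability over `↥S × ↥S` of the middle term (it is the secant term minus the commutator term).
[folklore] -/
private theorem summable_mid (hA : Adm₀ A) (hI : Inner₀ t A) (hu : ∀ s ∈ Sites₀ t A, ‖u s‖ ≤ 1 / 40)
    (hu₁ : ∀ s ∈ Sites₀ t A, ‖u₁ s‖ ≤ 1 / 40) (hR : 0 < R)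
    (hM : ∀ U : Finset (Sites₀ t A × Sites₀ t A), ∑ pq ∈ U, (if (pq.1 : (EuclideanSpace ℝ (Fin 3))) ≠ pq.2 then
      ((max 0 (min 1 (2 - dist (pq.1 : (EuclideanSpace ℝ (Fin 3))) c / R))) - (max 0 (min 1 (2 - dist (pq.2 : (EuclideanSpace ℝ (Fin 3))) c / R)))) ^ 2 * (dist (pq.1 : (EuclideanSpace ℝ (Fin 3))) pq.2)⁻¹ ^ 8 * ‖u₁ pq.1 - u pq.1‖ ^ 2 else 0) ≤ B) :
    Summable (Function.uncurry fun p q : Sites₀ t A =>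
      if (p : (EuclideanSpace ℝ (Fin 3))) ≠ q then ⟪((deriv lennardJones ‖((p : (EuclideanSpace ℝ (Fin 3))) + u₁ p - ((q : (EuclideanSpace ℝ (Fin 3))) + u₁ q))‖ / ‖((p : (EuclideanSpace ℝ (Fin 3))) + u₁ p - ((q : (EuclideanSpace ℝ (Fin 3))) + u₁ q))‖) • (((p : (EuclideanSpace ℝ (Fin 3))) + u₁ p - ((q : (EuclideanSpace ℝ (Fin 3))) + u₁ q)))) - ((deriv lennardJones ‖((p : (EuclideanSpace ℝ (Fin 3))) + u p - ((q : (EuclideanSpace ℝ (Fin 3))) + u q))‖ / ‖((p : (EuclideanSpace ℝ (Fin 3))) + u p - ((q : (EuclideanSpace ℝ (Fin 3))) + u q))‖) • (((p : (EuclideanSpace ℝ (Fin 3))) + u p - ((q : (EuclideanSpace ℝ (Fin 3))) + u q)))), ((max 0 (min 1 (2 - dist (p : (EuclideanSpace ℝ (Fin 3))) c / R))) ^ 2 • (u₁ p - u p)) - ((max 0 (min 1 (2 - dist (q : (EuclideanSpace ℝ (Fin 3))) c / R))) ^ 2 • (u₁ q - u q))⟫_ℝ else 0) := by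
  have h := (flatDiff_summable_secant (c := c) hA hI hu hu₁ hR).sub (summable_comm hA hI hu hu₁ hM)
  refine h.congr fun pq => ?_
  obtain ⟨p, q⟩ := pq
  simp only [Function.uncurry_apply_pair]
  by_cases hpq : (p : (EuclideanSpace ℝ (Fin 3))) ≠ q
  · rw [if_pos hpq, if_pos hpq, if_pos hpq, secant_eq_mid_add_comm hA hI hu hu₁ p.2 q.2 hpq]
    ring
  · simp only [if_neg hpq, sub_zero]

/-- Summability over `↥S × ↥S` of the second half `⟪F(b) − F(a), ψ q⟫` of the middle term. [folklore] -/
private theorem summable_mid₂ (hA : Adm₀ A) (hI : Inner₀ t A) (hu : ∀ s ∈ Sites₀ t A, ‖u s‖ ≤ 1 / 40)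
    (hu₁ : ∀ s ∈ Sites₀ t A, ‖u₁ s‖ ≤ 1 / 40) (hR : 0 < R)
    (hEq : ∀ p : Sites₀ t A, HasSum (fun q : Sites₀ t A =>
      if (p : (EuclideanSpace ℝ (Fin 3))) ≠ q then ((deriv lennardJones ‖((p : (EuclideanSpace ℝ (Fin 3))) + u₁ p - ((q : (EuclideanSpace ℝ (Fin 3))) + u₁ q))‖ / ‖((p : (EuclideanSpace ℝ (Fin 3))) + u₁ p - ((q : (EuclideanSpace ℝ (Fin 3))) + u₁ q))‖) • (((p : (EuclideanSpace ℝ (Fin 3))) + u₁ p - ((q : (EuclideanSpace ℝ (Fin 3))) + u₁ q)))) - ((deriv lennardJones ‖((p : (EuclideanSpace ℝ (Fin 3))) + u p - ((q : (EuclideanSpace ℝ (Fin 3))) + u q))‖ / ‖((p : (EuclideanSpace ℝ (Fin 3))) + u p - ((q : (EuclideanSpace ℝ (Fin 3))) + u q))‖) • (((p : (EuclideanSpace ℝ (Fin 3))) + u p - ((q : (EuclideanSpace ℝ (Fin 3))) + u q)))) else 0) 0)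
    (hM : ∀ U : Finset (Sites₀ t A × Sites₀ t A), ∑ pq ∈ U, (if (pq.1 : (EuclideanSpace ℝ (Fin 3))) ≠ pq.2 then
      ((max 0 (min 1 (2 - dist (pq.1 : (EuclideanSpace ℝ (Fin 3))) c / R))) - (max 0 (min 1 (2 - dist (pq.2 : (EuclideanSpace ℝ (Fin 3))) c / R)))) ^ 2 * (dist (pq.1 : (EuclideanSpace ℝ (Fin 3))) pq.2)⁻¹ ^ 8 * ‖u₁ pq.1 - u pq.1‖ ^ 2 else 0) ≤ B) :
    Summable (Function.uncurry fun p q : Sites₀ t A =>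
      if (p : (EuclideanSpace ℝ (Fin 3))) ≠ q then ⟪((deriv lennardJones ‖((p : (EuclideanSpace ℝ (Fin 3))) + u₁ p - ((q : (EuclideanSpace ℝ (Fin 3))) + u₁ q))‖ / ‖((p : (EuclideanSpace ℝ (Fin 3))) + u₁ p - ((q : (EuclideanSpace ℝ (Fin 3))) + u₁ q))‖) • (((p : (EuclideanSpace ℝ (Fin 3))) + u₁ p - ((q : (EuclideanSpace ℝ (Fin 3))) + u₁ q)))) - ((deriv lennardJones ‖((p : (EuclideanSpace ℝ (Fin 3))) + u p - ((q : (EuclideanSpace ℝ (Fin 3))) + u q))‖ / ‖((p : (EuclideanSpace ℝ (Fin 3))) + u p - ((q : (EuclideanSpace ℝ (Fin 3))) + u q))‖) • (((p : (EuclideanSpace ℝ (Fin 3))) + u p - ((q : (EuclideanSpace ℝ (Fin 3))) + u q)))), ((max 0 (min 1 (2 - dist (q : (EuclideanSpace ℝ (Fin 3))) c / R))) ^ 2 • (u₁ q - u q))⟫_ℝ else 0) := by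
  have h := (summable_mid₁ (u := u) (u₁ := u₁) (c := c) hA hI hR hEq).sub (summable_mid hA hI hu hu₁ hR hM)
  refine h.congr fun pq => ?_
  obtain ⟨p, q⟩ := pq
  simp only [Function.uncurry_apply_pair]
  split_ifs
  · rw [inner_sub_right]; ring
  · simp

/-- **The middle term sums to zero** over `↥S × ↥S`: row sums of `⟪F(b) − F(a), ψ p⟫` vanish by the
difference equation, and so do the column sums of `⟪F(b) − F(a), ψ q⟫` by antisymmetry; Fubini is
legitimate by absolute summability. [folklore] -/
private theorem tsum_mid_eq_zero (hA : Adm₀ A) (hI : Inner₀ t A) (hu : ∀ s ∈ Sites₀ t A, ‖u s‖ ≤ 1 / 40)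
    (hu₁ : ∀ s ∈ Sites₀ t A, ‖u₁ s‖ ≤ 1 / 40) (hR : 0 < R)
    (hEq : ∀ p : Sites₀ t A, HasSum (fun q : Sites₀ t A =>
      if (p : (EuclideanSpace ℝ (Fin 3))) ≠ q then ((deriv lennardJones ‖((p : (EuclideanSpace ℝ (Fin 3))) + u₁ p - ((q : (EuclideanSpace ℝ (Fin 3))) + u₁ q))‖ / ‖((p : (EuclideanSpace ℝ (Fin 3))) + u₁ p - ((q : (EuclideanSpace ℝ (Fin 3))) + u₁ q))‖) • (((p : (EuclideanSpace ℝ (Fin 3))) + u₁ p - ((q : (EuclideanSpace ℝ (Fin 3))) + u₁ q)))) - ((deriv lennardJones ‖((p : (EuclideanSpace ℝ (Fin 3))) + u p - ((q : (EuclideanSpace ℝ (Fin 3))) + u q))‖ / ‖((p : (EuclideanSpace ℝ (Fin 3))) + u p - ((q : (EuclideanSpace ℝ (Fin 3))) + u q))‖) • (((p : (EuclideanSpace ℝ (Fin 3))) + u p - ((q : (EuclideanSpace ℝ (Fin 3))) + u q)))) else 0) 0)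
    (hM : ∀ U : Finset (Sites₀ t A × Sites₀ t A), ∑ pq ∈ U, (if (pq.1 : (EuclideanSpace ℝ (Fin 3))) ≠ pq.2 then
      ((max 0 (min 1 (2 - dist (pq.1 : (EuclideanSpace ℝ (Fin 3))) c / R))) - (max 0 (min 1 (2 - dist (pq.2 : (EuclideanSpace ℝ (Fin 3))) c / R)))) ^ 2 * (dist (pq.1 : (EuclideanSpace ℝ (Fin 3))) pq.2)⁻¹ ^ 8 * ‖u₁ pq.1 - u pq.1‖ ^ 2 else 0) ≤ B) :
    ∑' pq : Sites₀ t A × Sites₀ t A, Function.uncurry (fun p q : Sites₀ t A =>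
      if (p : (EuclideanSpace ℝ (Fin 3))) ≠ q then ⟪((deriv lennardJones ‖((p : (EuclideanSpace ℝ (Fin 3))) + u₁ p - ((q : (EuclideanSpace ℝ (Fin 3))) + u₁ q))‖ / ‖((p : (EuclideanSpace ℝ (Fin 3))) + u₁ p - ((q : (EuclideanSpace ℝ (Fin 3))) + u₁ q))‖) • (((p : (EuclideanSpace ℝ (Fin 3))) + u₁ p - ((q : (EuclideanSpace ℝ (Fin 3))) + u₁ q)))) - ((deriv lennardJones ‖((p : (EuclideanSpace ℝ (Fin 3))) + u p - ((q : (EuclideanSpace ℝ (Fin 3))) + u q))‖ / ‖((p : (EuclideanSpace ℝ (Fin 3))) + u p - ((q : (EuclideanSpace ℝ (Fin 3))) + u q))‖) • (((p : (EuclideanSpace ℝ (Fin 3))) + u p - ((q : (EuclideanSpace ℝ (Fin 3))) + u q)))), ((max 0 (min 1 (2 - dist (p : (EuclideanSpace ℝ (Fin 3))) c / R))) ^ 2 • (u₁ p - u p)) - ((max 0 (min 1 (2 - dist (q : (EuclideanSpace ℝ (Fin 3))) c / R))) ^ 2 • (u₁ q - u q))⟫_ℝ else 0) pq = 0 := by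
  have h1 := summable_mid₁ (u := u) (u₁ := u₁) (c := c) hA hI hR hEq
  have h2 := summable_mid₂ hA hI hu hu₁ hR hEq hM
  have h := summable_mid hA hI hu hu₁ hR hM
  set M₁ : Sites₀ t A → Sites₀ t A → ℝ := fun p q =>
    if (p : (EuclideanSpace ℝ (Fin 3))) ≠ q then ⟪((deriv lennardJones ‖((p : (EuclideanSpace ℝ (Fin 3))) + u₁ p - ((q : (EuclideanSpace ℝ (Fin 3))) + u₁ q))‖ / ‖((p : (EuclideanSpace ℝ (Fin 3))) + u₁ p - ((q : (EuclideanSpace ℝ (Fin 3))) + u₁ q))‖) • (((p : (EuclideanSpace ℝ (Fin 3))) + u₁ p - ((q : (EuclideanSpace ℝ (Fin 3))) + u₁ q)))) - ((deriv lennardJones ‖((p : (EuclideanSpace ℝ (Fin 3))) + u p - ((q : (EuclideanSpace ℝ (Fin 3))) + u q))‖ / ‖((p : (EuclideanSpace ℝ (Fin 3))) + u p - ((q : (EuclideanSpace ℝ (Fin 3))) + u q))‖) • (((p : (EuclideanSpace ℝ (Fin 3))) + u p - ((q : (EuclideanSpace ℝ (Fin 3))) + u q)))), ((max 0 (min 1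 (2 - dist (p : (EuclideanSpace ℝ (Fin 3))) c / R))) ^ 2 • (u₁ p - u p))⟫_ℝ else 0 with hM₁
  set M₂ : Sites₀ t A → Sites₀ t A → ℝ := fun p q =>
    if (p : (EuclideanSpace ℝ (Fin 3))) ≠ q then ⟪((deriv lennardJones ‖((p : (EuclideanSpace ℝ (Fin 3))) + u₁ p - ((q : (EuclideanSpace ℝ (Fin 3))) + u₁ q))‖ / ‖((p : (EuclideanSpace ℝ (Fin 3))) + u₁ p - ((q : (EuclideanSpace ℝ (Fin 3))) + u₁ q))‖) • (((p : (EuclideanSpace ℝ (Fin 3))) + u₁ p - ((q : (EuclideanSpace ℝ (Fin 3))) + u₁ q)))) - ((deriv lennardJones ‖((p : (EuclideanSpace ℝ (Fin 3))) + u p - ((q : (EuclideanSpace ℝ (Fin 3))) + u q))‖ / ‖((p : (EuclideanSpace ℝ (Fin 3))) + u p - ((q : (EuclideanSpace ℝ (Fin 3))) + u q))‖) • (((p : (EuclideanSpace ℝ (Fin 3))) + u p - ((q : (EuclideanSpace ℝ (Fin 3))) + u q)))), ((max 0 (min 1 (2 - dist (q : (EuclideanSpace ℝ (Fin 3))) c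 / R))) ^ 2 • (u₁ q - u q))⟫_ℝ else 0 with hM₂
  set M : Sites₀ t A → Sites₀ t A → ℝ := fun p q =>
    if (p : (EuclideanSpace ℝ (Fin 3))) ≠ q then ⟪((deriv lennardJones ‖((p : (EuclideanSpace ℝ (Fin 3))) + u₁ p - ((q : (EuclideanSpace ℝ (Fin 3))) + u₁ q))‖ / ‖((p : (EuclideanSpace ℝ (Fin 3))) + u₁ p - ((q : (EuclideanSpace ℝ (Fin 3))) + u₁ q))‖) • (((p : (EuclideanSpace ℝ (Fin 3))) + u₁ p - ((q : (EuclideanSpace ℝ (Fin 3))) + u₁ q)))) - ((deriv lennardJones ‖((p : (EuclideanSpace ℝ (Fin 3))) + u p - ((q : (EuclideanSpace ℝ (Fin 3))) + u q))‖ / ‖((p : (EuclideanSpace ℝ (Fin 3))) + u p - ((q : (EuclideanSpace ℝ (Fin 3))) + u q))‖) • (((p : (EuclideanSpace ℝ (Fin 3))) + u p - ((q : (EuclideanSpace ℝ (Fin 3))) + u q)))), ((max 0 (min 1 (2 - dist (p : (EuclideanSpace ℝ (Fin 3))) c / R))) ^ 2 • (u₁ p - u p)) - ((max 0 (min 1 (2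 - dist (q : (EuclideanSpace ℝ (Fin 3))) c / R))) ^ 2 • (u₁ q - u q))⟫_ℝ else 0 with hMd
  -- row sums of `M₁` vanish
  have hrow : ∀ p : Sites₀ t A, ∑' q : Sites₀ t A, M₁ p q = 0 :=
    fun p => (hasSum_mid_row hEq p).tsum_eq
  have hsum1 : ∑' pq : Sites₀ t A × Sites₀ t A, Function.uncurry M₁ pq = 0 := by
    rw [h1.tsum_prod_uncurry fun p => h1.prod_factor p]
    simp only [hrow, tsum_zero]
  -- column sums of `M₂` vanish
  have hcol : ∀ q : Sites₀ t A, ∑' p : Sites₀ t A, M₂ p q = 0 := by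
    intro q
    have hq := congrArg Neg.neg (hrow q)
    rw [neg_zero, ← tsum_neg] at hq
    refine Eq.trans (tsum_congr fun p => ?_) hq
    simp only [hM₁, hM₂]
    by_cases hpq : (p : (EuclideanSpace ℝ (Fin 3))) ≠ q
    · rw [if_pos hpq, if_pos (Ne.symm hpq), forceDiff_antisymm (u := u) (u₁ := u₁) (p : (EuclideanSpace ℝ (Fin 3))) q,
        inner_neg_left]
    · rw [if_neg hpq, if_neg (fun h => hpq (Ne.symm h)), neg_zero]
  have hN : Summable (Function.uncurry fun q p : Sites₀ t A => M₂ p q) := h2.prod_symm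
  have hsum2 : ∑' pq : Sites₀ t A × Sites₀ t A, Function.uncurry M₂ pq = 0 := by
    calc ∑' pq : Sites₀ t A × Sites₀ t A, Function.uncurry M₂ pq
        = ∑' pq : Sites₀ t A × Sites₀ t A, Function.uncurry (fun q p : Sites₀ t A => M₂ p q) pq :=
          (Equiv.prodComm (Sites₀ t A) (Sites₀ t A)).tsum_eq
            (Function.uncurry fun q p : Sites₀ t A => M₂ p q)
      _ = ∑' q : Sites₀ t A, ∑' p : Sites₀ t A, M₂ p q := hN.tsum_prod_uncurry fun q => hN.prod_factor q
      _ = 0 := by simp only [hcol, tsum_zero]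
  -- combine
  have hsplit := h1.tsum_sub h2
  rw [hsum1, hsum2, sub_zero] at hsplit
  rw [← hsplit]
  refine tsum_congr fun pq => ?_
  simp only [Function.uncurry, hM₁, hM₂, hMd]
  split_ifs
  · rw [inner_sub_right]
  · simp

/-! ## The linear Caccioppoli inequality -/

/-- **The secant form of the cut-off difference field is controlled by the commutator weights**:
`Σ_{(p,q)} secHess a_pq δ_pq (φ p − φ q) ≤ 904(10/9)⁸ · B` whenever the weights
`(χ p − χ q)² (dist p q)⁻⁸ ‖w p‖²` have partial sums `≤ B`. [folklore] -/
private theorem secForm_le (hA : Adm₀ A) (hI : Inner₀ t A) (hu : ∀ s ∈ Sites₀ t A, ‖u s‖ ≤ 1 / 40)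
    (hu₁ : ∀ s ∈ Sites₀ t A, ‖u₁ s‖ ≤ 1 / 40) (hR : 0 < R)
    (hEq : ∀ p : Sites₀ t A, HasSum (fun q : Sites₀ t A =>
      if (p : (EuclideanSpace ℝ (Fin 3))) ≠ q then ((deriv lennardJones ‖((p : (EuclideanSpace ℝ (Fin 3))) + u₁ p - ((q : (EuclideanSpace ℝ (Fin 3))) + u₁ q))‖ / ‖((p : (EuclideanSpace ℝ (Fin 3))) + u₁ p - ((q : (EuclideanSpace ℝ (Fin 3))) + u₁ q))‖) • (((p : (EuclideanSpace ℝ (Fin 3))) + u₁ p - ((q : (EuclideanSpace ℝ (Fin 3))) + u₁ q)))) - ((deriv lennardJones ‖((p : (EuclideanSpace ℝ (Fin 3))) + u p - ((q : (EuclideanSpace ℝ (Fin 3))) + u q))‖ / ‖((p : (EuclideanSpace ℝ (Fin 3))) + u p - ((q : (EuclideanSpace ℝ (Fin 3))) + u q))‖) • (((p : (EuclideanSpace ℝ (Fin 3))) + u p - ((q : (EuclideanSpace ℝ (Fin 3))) + u q)))) else 0) 0)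
    (hM : ∀ U : Finset (Sites₀ t A × Sites₀ t A), ∑ pq ∈ U, (if (pq.1 : (EuclideanSpace ℝ (Fin 3))) ≠ pq.2 then
      ((max 0 (min 1 (2 - dist (pq.1 : (EuclideanSpace ℝ (Fin 3))) c / R))) - (max 0 (min 1 (2 - dist (pq.2 : (EuclideanSpace ℝ (Fin 3))) c / R)))) ^ 2 * (dist (pq.1 : (EuclideanSpace ℝ (Fin 3))) pq.2)⁻¹ ^ 8 * ‖u₁ pq.1 - u pq.1‖ ^ 2 else 0) ≤ B) :
    ∑' pq : Sites₀ t A × Sites₀ t A, (if (pq.1 : (EuclideanSpace ℝ (Fin 3))) ≠ pq.2 then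
        secHess (((pq.1 : (EuclideanSpace ℝ (Fin 3))) + u pq.1 - ((pq.2 : (EuclideanSpace ℝ (Fin 3))) + u pq.2))) (((u₁ pq.1 - u pq.1) - (u₁ pq.2 - u pq.2))) ((max 0 (min 1 (2 - dist (pq.1 : (EuclideanSpace ℝ (Fin 3))) c / R)) • (u₁ pq.1 - u pq.1)) - (max 0 (min 1 (2 - dist (pq.2 : (EuclideanSpace ℝ (Fin 3))) c / R)) • (u₁ pq.2 - u pq.2))) else 0) ≤
      904 * (10 / 9) ^ 8 * B := by
  have hmid := summable_mid hA hI hu hu₁ hR hM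
  have hcomm := summable_comm hA hI hu hu₁ hM
  have hsplit := hmid.tsum_add hcomm
  rw [tsum_mid_eq_zero hA hI hu hu₁ hR hEq hM, zero_add] at hsplit
  refine le_trans (le_of_eq ?_) ((le_of_eq hsplit).trans (tsum_comm_le hA hI hu hu₁ hM))
  refine tsum_congr fun pq => ?_
  simp only [Function.uncurry]
  by_cases hpq : (pq.1 : (EuclideanSpace ℝ (Fin 3))) ≠ pq.2
  · rw [if_pos hpq, if_pos hpq, if_pos hpq, secant_eq_mid_add_comm hA hI hu hu₁ pq.1.2 pq.2.2 hpq]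
  · simp only [if_neg hpq, add_zero]

/-- **The linear Caccioppoli estimate**: under `BoxCoercive (1/40) κ₁`, for two `1/40`-bounded
displacements `u, u₁` of the sites of an admissible hcp datum satisfying the difference equation, the
cut-off difference field `φ = χ·(u₁ − u)` obeys `2κ₁ · nnForm t A φ ≤ 904(10/9)⁸ · B`, `B` any bound for
the partial sums of the commutator weights `(χ p − χ q)² (dist p q)⁻⁸ ‖u₁ p − u p‖²`. [folklore] -/
theorem flatDiff_caccioppoli_estimate (hA : Adm₀ A) (hI : Inner₀ t A) (hBox : BoxCoercive (1 / 40) κ₁)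
    (hu : ∀ s ∈ Sites₀ t A, ‖u s‖ ≤ 1 / 40) (hu₁ : ∀ s ∈ Sites₀ t A, ‖u₁ s‖ ≤ 1 / 40) (hR : 0 < R)
    (hEq : ∀ p : Sites₀ t A, HasSum (fun q : Sites₀ t A =>
      if (p : (EuclideanSpace ℝ (Fin 3))) ≠ q then ((deriv lennardJones ‖((p : (EuclideanSpace ℝ (Fin 3))) + u₁ p - ((q : (EuclideanSpace ℝ (Fin 3))) + u₁ q))‖ / ‖((p : (EuclideanSpace ℝ (Fin 3))) + u₁ p - ((q : (EuclideanSpace ℝ (Fin 3))) + u₁ q))‖) • (((p : (EuclideanSpace ℝ (Fin 3))) + u₁ p - ((q : (EuclideanSpace ℝ (Fin 3))) + u₁ q)))) - ((deriv lennardJones ‖((p : (EuclideanSpace ℝ (Fin 3))) + u p - ((q : (EuclideanSpace ℝ (Fin 3))) + u q))‖ / ‖((p : (EuclideanSpace ℝ (Fin 3))) + u p - ((q : (EuclideanSpace ℝ (Fin 3))) + u q))‖) • (((p : (EuclideanSpace ℝ (Fin 3))) + u p - ((q : (EuclideanSpace ℝ (Fin 3))) + u q)))) else 0) 0)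
    (hM : ∀ U : Finset (Sites₀ t A × Sites₀ t A), ∑ pq ∈ U, (if (pq.1 : (EuclideanSpace ℝ (Fin 3))) ≠ pq.2 then
      ((max 0 (min 1 (2 - dist (pq.1 : (EuclideanSpace ℝ (Fin 3))) c / R))) - (max 0 (min 1 (2 - dist (pq.2 : (EuclideanSpace ℝ (Fin 3))) c / R)))) ^ 2 * (dist (pq.1 : (EuclideanSpace ℝ (Fin 3))) pq.2)⁻¹ ^ 8 * ‖u₁ pq.1 - u pq.1‖ ^ 2 else 0) ≤ B) :
    2 * κ₁ * nnForm t A (fun x : (EuclideanSpace ℝ (Fin 3)) => if x ∈ Sites₀ t A then (max 0 (min 1 (2 - dist (x : (EuclideanSpace ℝ (Fin 3))) c / R)) • (u₁ x - u x)) else 0) ≤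
      904 * (10 / 9) ^ 8 * B :=
  (flatDiff_coercive_integrated hA hI hBox hu hu₁ hR).trans (secForm_le hA hI hu hu₁ hR hEq hM)

/-- Registered form of `flatDiff_caccioppoli_estimate` (sub-goal of crux stmt-AtomisticToContinuum-9332, line
`Sketch`): the linear Caccioppoli estimate for the difference of two equilibria. [folklore] -/
theorem hcpLiouville_caccioppoli_estimate : ∀ (κ₁ B : ℝ) (t : Fin 2 → (EuclideanSpace ℝ (Fin 3))) (A : (EuclideanSpace ℝ (Fin 3)) →L[ℝ] (EuclideanSpace ℝ (Fin 3))) (u u₁ : (EuclideanSpace ℝ (Fin 3)) → (EuclideanSpace ℝ (Fin 3))) (c : (EuclideanSpace ℝ (Fin 3))) (R : ℝ), Adm₀ A → Inner₀ t A → BoxCoercive (1 / 40) κ₁ → (∀ s ∈ Sites₀ t A, ‖u s‖ ≤ 1 / 40) → (∀ s ∈ Sites₀ t A, ‖u₁ s‖ ≤ 1 / 40) → 0 < R → (∀ p : Sites₀ t A, HasSum (fun q : Sites₀ t A => if (p : (EuclideanSpace ℝ (Fin 3))) ≠ q then (deriv lennardJones ‖(p : (EuclideanSpace ℝ (Fin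 3))) + u₁ p - ((q : (EuclideanSpace ℝ (Fin 3))) + u₁ q)‖ / ‖(p : (EuclideanSpace ℝ (Fin 3))) + u₁ p - ((q : (EuclideanSpace ℝ (Fin 3))) + u₁ q)‖) • ((p : (EuclideanSpace ℝ (Fin 3))) + u₁ p - ((q : (EuclideanSpace ℝ (Fin 3))) + u₁ q)) - (deriv lennardJones ‖(p : (EuclideanSpace ℝ (Fin 3))) + u p - ((q : (EuclideanSpace ℝ (Fin 3))) + u q)‖ / ‖(p : (EuclideanSpace ℝ (Fin 3))) + u p - ((q : (EuclideanSpace ℝ (Fin 3))) + u q)‖) • ((p : (EuclideanSpace ℝ (Fin 3))) + u p - ((q : (EuclideanSpace ℝ (Fin 3))) + u q)) else 0) 0) → (∀ U : Finset (Sites₀ t A × Sites₀ t A), ∑ pq ∈ U, (if (pq.1 : (EuclideanSpace ℝ (Fin 3))) ≠ pq.2 then (max 0 (min 1 (2 - dist (pq.1 : (EuclideanSpace ℝ (Fin 3))) c / R)) - max 0 (min 1 (2 - dist (pq.2 : (EuclideanSpace ℝ (Fin 3))) c / R))) ^ 2 * (dist (pq.1 : (EuclideanSpace ℝ (Fin 3)))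 pq.2)⁻¹ ^ 8 * ‖u₁ pq.1 - u pq.1‖ ^ 2 else 0) ≤ B) → 2 * κ₁ * nnForm t A (fun x : (EuclideanSpace ℝ (Fin 3)) => if x ∈ Sites₀ t A then max 0 (min 1 (2 - dist x c / R)) • (u₁ x - u x) else 0) ≤ 904 * (10 / 9) ^ 8 * B := by
  intro κ₁ B t A u u₁ c R hA hI hBox hu hu₁ hR hEq hM
  exact flatDiff_caccioppoli_estimate hA hI hBox hu hu₁ hR hEq hM

end Caccioppoli

end Summit.AtomisticToContinuum.Crystallization.Theorems.ExcessDecayLiouville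

end
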